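/-
Copyright (c) 2026 the pub-hodgecm-mathlib formalisation cell (harness21).  Prover seat hodgecm-mathlib-K2E2-p04 (g0),
Track B «K2-LIT» ∕ h413, unit ADM-REP of the line `K2_E2_ThetaExhaustionByRigidity`, file #4 (CLOSER): payment of the socket
`K2E2ThetaExhaustionByRigidity.AdmRep.sig_K2E2AdmRepresentative` = tier-0 `StubAdmissibleRepresentative` VERBATIM —
THE ADMISSIBLE REPRESENTATIVE OF A PARITY-EVEN LINE.  2026-09-03.
-/
import Summits.HodgeConjecture.HodgeConjecture.Theorems.F0P2fStubEPE3finGlobalEps   -- ★ `stubE3fin_holds` (`{v : [a]_v ≠ 1}` finite, HR 71:18), `imagUnitSq_ne_zero'`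
import Summits.HodgeConjecture.HodgeConjecture.Theorems.H413ThetaPinBridge         -- ★ `two_mul_imagUnit_inv_ne_zero`, `complexConj_two_mul_imagUnit_inv` (bookkeeping on `(2δ_L)⁻¹`, reused by name)
import Literature.NumberTheory.Automorphic.Liu2021.Def412AdmissibleIffParity        -- ★ `isAdmissible_epsOf_iff_even` ([Liu2021, Def. 4.12] ⟺ parity), `embedding_of_isReal_lt_zero_of_coe_eq_mul_self`
import Literature.NumberTheory.Automorphic.ConjugateSelfDualInfinityType            -- ★ `IsConjugateSymplectic.cmType` (the CM type `Φ_μ`, [Liu2021, Def. 4.3])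
import HarnessLib

/-!
# K2_E2 road (h413 = stmt-HodgeConjecture-24833), unit ADM-REP, file #4 (closer):
# a parity-even line has a representative `a′` with `a′ · (2δ_L)⁻¹` admissible for the CM type of `μ`

Cell `pub/hodgecm-mathlib` (D-0151), Track B (21-frontier RULING «PUSH BOTH» 2026-09-03, director req621∕req624, chair K2-lead
ORDER #1 §4.4 ∕ ORDER #2, SKELETON LANDED K2E2 2026-09-03T21:02:16Z), socket module
`Summits/HodgeConjecture/HodgeConjecture/Cruxes/H413/Lines/K2_E2_ThetaExhaustionByRigidity_AdmRep.lean` (planner K2E2-plan (g0),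
sha16 0ce0c102f00b9ca4), socket **`sig_K2E2AdmRepresentative`** (#4, size S, CLOSER: its statement is the tier-0
`K2E2ThetaExhaustionByRigidity.StubAdmissibleRepresentative` token for token, so the lead re-ties `stub_admissibleRepresentative` by `exact`).

THE MATHEMATICS [Liu2021, Def. 4.12 (l. 2102–2108), Rem. 4.14] [Omeara1963, §71 Thm. 71:18, Thm. 71:19, Cor. 71:19a].  Let `L` be a CM field,
`F = L⁺`, `δ_L = imagUnit L ∈ L^{×−}`, `d = δ_L² = imagUnitSq L ∈ F` (totally negative), `μ` a conjugate-symplectic character with CM type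
`Φ_μ = hμ.cmType`, and `a ∈ F^×` a line whose E3♭-count `#{v : [a]_v ≠ 1 in F_v^×⧸N(L_v^×)} + #{φ ∈ Φ_μ : Im φ((2δ_L)⁻¹) > 0}` is EVEN.
(1) The class family `v ↦ [a]_v` of a GLOBAL `a` is trivial at almost every finite place — Hilbert reciprocity 71:18, in the tree ★
`F0P2fStubEPE3finGlobalEps.stubE3fin_holds`.  (2) By ★ `Liu2021.isAdmissible_epsOf_iff_even` ([Liu2021, Def. 4.12] ⟺ parity; O'Meara 71:19 for
`F(√d)∕F`, `d` negative at every real place by ★ `embedding_of_isReal_lt_zero_of_coe_eq_mul_self`), read at the normaliser `(2δ_L)⁻¹ ∈ L^{×−}` and the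
collection `ε := locF a`, finiteness + evenness give an element `e ∈ L^{×−}`, `Φ_μ`-admissible (`Im φ(e) < 0` on `Φ_μ`), with `epsOf (2δ_L)⁻¹ e = locF a`.
(3) `a′ := e · 2δ_L` is conjugation-fixed, i.e. lies in `F`, is non-zero, satisfies `a′ · (2δ_L)⁻¹ = e` (so it is admissible) and
`locF a′ = epsOf (2δ_L)⁻¹ (a′ · (2δ_L)⁻¹) = epsOf (2δ_L)⁻¹ e = locF a` (★ `Def411WeilCarriers.epsOf_algebraMap_mul`).

PROOF STRATEGY (this seat): a SELF-CONTAINED closer straight from the ★ leaves (it does not import the sibling tier-2 files #1–#3 of the unit,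
which pay the same three steps one per file; the unit construction of step (3) is done by hand on the pattern of ★ `stubEP_holds`).

* §1 `exists_admissible_of_even` — step (2); `exists_unit_of_admissible` — step (3) (the bookkeeping on `(2δ_L)⁻¹` is ★
  `ThetaPinBridge.two_mul_imagUnit_inv_ne_zero` ∕ `complexConj_two_mul_imagUnit_inv`, on `δ_L² ≠ 0` ★ `F0P2fStubEPE3finGlobalEps.imagUnitSq_ne_zero'`).
* §2 **`admRepresentative`** — `sig_K2E2AdmRepresentative` TOKEN FOR TOKEN (tie probe at home
  `K2/K2E2-p04/g0/Probe_K2E2AdmRepresentative.lean`: `example : type_of% @admRepresentative =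
  type_of% @K2E2ThetaExhaustionByRigidity.AdmRep.sig_K2E2AdmRepresentative := rfl` once the socket module is BUILT on stream 29).

HONEST LABEL.  HC_CM is proved only modulo the 7 printed citations (2 remaining named inputs: hLiu418 = `stmt-HodgeConjecture-24832`, h413 =
`stmt-HodgeConjecture-24833`) until rung 0 closes; this file is a `--supports stmt-HodgeConjecture-24833` helper and moves no counter.

## References
* [Liu2021] Y. Liu, *Fourier–Jacobi cycles and arithmetic relative trace formula*, Camb. J. Math. 9 (2021) = arXiv:2102.11518 — Def. 4.3,
  Def. 4.11 (l. 2083–2097), Def. 4.12 (l. 2102–2108), Rem. 4.14.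
* [Omeara1963] O. T. O'Meara, *Introduction to Quadratic Forms*, Grundlehren 117 (1963) — §63B Cor. 63:13a, §65A, §71 Thm. 71:18, Thm. 71:19,
  Cor. 71:19a.
* [Rogawski1992] J. D. Rogawski, *The multiplicity formula for A-packets*, in: The zeta functions of Picard modular surfaces (1992) — Thm. 1.1.
-/

set_option autoImplicit false
-- the mandated namespace repeats the single-problem summit's segment (`HodgeConjecture.HodgeConjecture`)
set_option linter.dupNamespace false

noncomputable section

open NumberField NumberField.InfinitePlace IsDedekindDomain
open Literature.NumberTheory Literature.NumberTheory.Automorphic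
open Literature.NumberTheory.Automorphic.IdeleClassGroup
open Literature.NumberTheory.Automorphic.Liu2021 Literature.NumberTheory.Automorphic.Liu2021.Def411WeilCarriers
open Literature.NumberTheory.GelbartRogawski1991 Literature.NumberTheory.GelbartRogawski1991.UnitaryDualPair
open Literature.AlgebraicGeometry.Liu2021 (IsAdmissibleElement)

namespace Summit.HodgeConjecture.HodgeConjecture.Cruxes.H413.K2E2AdmRepresentative

/-! ## §1 The two steps -/

section Steps

variable (L : Type) [Field L] [NumberField L] [IsCMField L]

/-- **Step (2): parity-even ⟹ an admissible element with the prescribed collection.**  For a CM type `Φ` and a line `a ∈ (L⁺)ˣ` with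
`#{v : [a]_v ≠ 1} + #{φ ∈ Φ : Im φ((2δ_L)⁻¹) > 0}` even, some `e ∈ L^{×−}` is `Φ`-admissible with `epsOf (2δ_L)⁻¹ e = locF a`:
★ `isAdmissible_epsOf_iff_even Φ` (normaliser `(2δ_L)⁻¹`, `d := imagUnitSq L`, negative at every real place of `L⁺` by ★
`embedding_of_isReal_lt_zero_of_coe_eq_mul_self` since `(d : L) = δ_L · δ_L`) `.mpr`, fed with the finiteness ★ `stubE3fin_holds` (Hilbert reciprocity)
and the hypothesis. [cite: Liu2021, Def. 4.12 (l. 2102–2108), Rem. 4.14] [cite: Omeara1963, §71 Thm. 71:18, Thm. 71:19, Cor. 71:19a] -/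
theorem exists_admissible_of_even (Φ : Literature.AlgebraicGeometry.Motives.CMType L) (a : (↥(maximalRealSubfield L))ˣ)
    (heven : Even ({v : HeightOneSpectrum (𝓞 ↥(maximalRealSubfield L)) |
              locF (↥(maximalRealSubfield L)) (imagUnitSq L) a v ≠ 1}.ncard +
        {φ : L →+* ℂ | φ ∈ Φ.1 ∧ 0 < (φ (2 * imagUnit L)⁻¹).im}.ncard)) :
    ∃ e : L, IsAdmissibleElement L Φ.1 e ∧
      epsOf (↥(maximalRealSubfield L)) (imagUnitSq L) L (2 * imagUnit L)⁻¹ e =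
        locF (↥(maximalRealSubfield L)) (imagUnitSq L) a :=
  (isAdmissible_epsOf_iff_even L Φ (ThetaPinBridge.complexConj_two_mul_imagUnit_inv L)
      (ThetaPinBridge.two_mul_imagUnit_inv_ne_zero L) (imagUnitSq L) (F0P2fStubEPE3finGlobalEps.imagUnitSq_ne_zero' L)
      (fun w hw => embedding_of_isReal_lt_zero_of_coe_eq_mul_self (complexConj_imagUnit L) (imagUnit_ne_zero L)
        (imagUnit_mul_self L).symm w hw)
      (locF (↥(maximalRealSubfield L)) (imagUnitSq L) a)).mpr
    ⟨F0P2fStubEPE3finGlobalEps.stubE3fin_holds L a, heven⟩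

/-- **Step (3): from an admissible element to an admissible UNIT REPRESENTATIVE of the same collection.**  If `e` is `Φ`-admissible with
`epsOf (2δ_L)⁻¹ e = locF a`, then `a′ := e · 2δ_L` lies in `(L⁺)ˣ` (conjugation-fixed, non-zero), `a′ · (2δ_L)⁻¹ = e` is `Φ`-admissible, and
`locF a′ = epsOf (2δ_L)⁻¹ e = locF a` (★ `epsOf_algebraMap_mul`). [cite: Liu2021, Def. 4.12 (l. 2102–2108)] -/
theorem exists_unit_of_admissible (Φ : Set (L →+* ℂ)) (a : (↥(maximalRealSubfield L))ˣ) {e : L} (he : IsAdmissibleElement L Φ e)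
    (heps : epsOf (↥(maximalRealSubfield L)) (imagUnitSq L) L (2 * imagUnit L)⁻¹ e =
      locF (↥(maximalRealSubfield L)) (imagUnitSq L) a) :
    ∃ a' : (↥(maximalRealSubfield L))ˣ,
      locF (↥(maximalRealSubfield L)) (imagUnitSq L) a' = locF (↥(maximalRealSubfield L)) (imagUnitSq L) a ∧
      IsAdmissibleElement L Φ (algebraMap (↥(maximalRealSubfield L)) L a' * (2 * imagUnit L)⁻¹) := by
  have hδ0 := ThetaPinBridge.two_mul_imagUnit_inv_ne_zero L
  -- `a′ := e · ((2δ)⁻¹)⁻¹ = e · 2δ` lies in `L⁺`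
  have hmemF : e * ((2 * imagUnit L)⁻¹)⁻¹ ∈ maximalRealSubfield L := by
    rw [← IsCMField.complexConj_eq_self_iff, map_mul, map_inv₀, ThetaPinBridge.complexConj_two_mul_imagUnit_inv L, he.2.1,
      inv_neg, neg_mul_neg]
  have hθ0 : (⟨e * ((2 * imagUnit L)⁻¹)⁻¹, hmemF⟩ : ↥(maximalRealSubfield L)) ≠ 0 := by
    intro h
    have : e * ((2 * imagUnit L)⁻¹)⁻¹ = 0 := congrArg Subtype.val h
    exact mul_ne_zero he.1 (inv_ne_zero hδ0) this
  have hval : algebraMap (↥(maximalRealSubfield L)) L (Units.mk0 _ hθ0 : (↥(maximalRealSubfield L))ˣ) * (2 * imagUnit L)⁻¹ = e := by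
    change e * ((2 * imagUnit L)⁻¹)⁻¹ * (2 * imagUnit L)⁻¹ = e
    rw [inv_mul_cancel_right₀ hδ0]
  refine ⟨Units.mk0 _ hθ0, ?_, ?_⟩
  · rw [← heps, ← epsOf_algebraMap_mul (↥(maximalRealSubfield L)) (imagUnitSq L) L (2 * imagUnit L)⁻¹ hδ0, hval]
  · rw [hval]
    exact he

end Steps

/-! ## §2 The head -/

/-- **PAYMENT OF `sig_K2E2AdmRepresentative`** (socket #4 = CLOSER of unit ADM-REP of the K2_E2 road,
`Cruxes/H413/Lines/K2_E2_ThetaExhaustionByRigidity_AdmRep.lean`; statement = tier-0 `K2E2ThetaExhaustionByRigidity.StubAdmissibleRepresentative`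
TOKEN FOR TOKEN).  For a conjugate-symplectic `μ` (CM type `Φ_μ = hμ.cmType`) and a line `a ∈ (L⁺)ˣ` whose E3♭-count
`#{v : [a]_v ≠ 1} + #{φ ∈ Φ_μ : Im φ((2δ_L)⁻¹) > 0}` is even, there is `a′ ∈ (L⁺)ˣ` with `locF a′ = locF a` and `a′ · (2δ_L)⁻¹` `Φ_μ`-admissible:
step (2) `exists_admissible_of_even hμ.cmType` then step (3) `exists_unit_of_admissible hμ.cmType.1`.
[cite: Liu2021, Def. 4.12 (l. 2102–2108); Rem. 4.14] [cite: Omeara1963, §71 Thm. 71:18, Thm. 71:19, Cor. 71:19a] [cite: Rogawski1992, Thm. 1.1] -/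
theorem admRepresentative :
    ∀ (L : Type) [Field L] [NumberField L] [IsCMField L]
      (μ : Literature.NumberTheory.Automorphic.IdeleClassGroup L →ₜ* Circle) (hμ : IsConjugateSymplectic L μ)
      (a : (↥(maximalRealSubfield L))ˣ),
      Even ({v : HeightOneSpectrum (𝓞 ↥(maximalRealSubfield L)) |
              locF (↥(maximalRealSubfield L)) (imagUnitSq L) a v ≠ 1}.ncard +
        {φ : L →+* ℂ | φ ∈ hμ.cmType.1 ∧ 0 < (φ (2 * imagUnit L)⁻¹).im}.ncard) →
      ∃ a' : (↥(maximalRealSubfield L))ˣ,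
        locF (↥(maximalRealSubfield L)) (imagUnitSq L) a' = locF (↥(maximalRealSubfield L)) (imagUnitSq L) a ∧
        IsAdmissibleElement L hμ.cmType.1 (algebraMap (↥(maximalRealSubfield L)) L a' * (2 * imagUnit L)⁻¹) := by
  intro L _ _ _ μ hμ a heven
  obtain ⟨e, he, heps⟩ := exists_admissible_of_even L hμ.cmType a heven
  exact exists_unit_of_admissible L hμ.cmType.1 a he heps

end Summit.HodgeConjecture.HodgeConjecture.Cruxes.H413.K2E2AdmRepresentative

end
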